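import Literature.Computability.Cryptography.ObfuscatedGluedTrees

/-!
# Stub `stub_parityFP` — the parity of an `FP` unary schedule is an `FP` bit
# (crux `WbwObfuscatedGluedTrees`, stmt-QuantumAdvantage-2340; line `knowledge-of-walk-split`, stage 4, lead c3)

Registered stub of the stage-4 skeleton `Cruxes/WbwObfuscatedGluedTrees/Lines/knowledge_of_walk_split.lean`
(target `…Generator.Residual.ResidualAudit`): for `c : ℕ → ℕ` computed on unary numerals by an `FP` string
function, the bit `n ↦ [c n % 2 = 1]` is computed on unary numerals by an `FP` string function — three
combinators of the tree's typed calculus `CodeFP` (`natOfUn`, `natMod`, `natEq`). Generic; no crux content.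
-/

set_option linter.dupNamespace false

namespace Summit.QuantumAdvantage.QuantumAdvantage.Theorems.WbwObfuscatedGluedTrees.KnowledgeOfWalk.Residual

open Literature.Computability.Complexity
open Literature.Computability.Complexity.CodeFP (unE bitE pairE strE natE)

/-- **Stub `stub_parityFP`**: the parity bit of an `FP` unary schedule is `FP` (unary → binary by `natOfUn`,
remainder by `natMod`, comparison with `1` by `natEq`). [folklore] -/
theorem stub_parityFP :
    ∀ c : ℕ → ℕ, CodeFP unE unE c → CodeFP unE bitE (fun n => decide (c n % 2 = 1)) := by
  intro c hc
  have h1 : CodeFP unE natE (fun n => c n) := CodeFP.natOfUn.comp hc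
  have h2 : CodeFP unE natE (fun n => c n % 2) :=
    CodeFP.natMod.comp (h1.pair (CodeFP.const unE (2 : ℕ)))
  exact (CodeFP.natEq.comp (h2.pair (CodeFP.const unE (1 : ℕ)))).congr fun _ => rfl

end Summit.QuantumAdvantage.QuantumAdvantage.Theorems.WbwObfuscatedGluedTrees.KnowledgeOfWalk.Residual
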